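import Summits.NavierStokesRegularity.NavierStokesRegularity.Theses.AxisymmetricExtremality
import Summits.NavierStokesRegularity.NavierStokesRegularity.Theorems.AxisymmetricExtremalityAxisymmetricKatoGlobalStubSeregin2020TypeIISwirlVanishes
import HarnessLib

/-!
# Seregin 2020, proof of Thm 2.1: `Γ ≡ 0` for the ancient limit, modulo Lemma 2.2 — with the
# CORRECTED rendering of the lemma (SUPERsolutions, drift norm on `B(2R)`, `div U = 0`)

Helper toward the stub `stub_seregin2020TypeII` of the crux `AxisymmetricKatoGlobal` (= the named
fact `Literature.Analysis.FluidPDE.Seregin2020_axisymmetricSingularPoint_typeII`, G. Seregin,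
Anal. Math. Phys. 10 (2020) Paper 46 = arXiv:2006.04140, Thm 2.1). This file SUPERSEDES the
sibling `…SwirlVanishes` (`ae_swirl_eq_zero_of_weakHarnack`, p171325), whose written-out
Lemma-2.2 hypothesis `hWH` copies the paper's (2.12) `∂ₜπ + (u + 2x'/|x'|²)·∇π - Δπ ≤ 0`
(SUBsolutions) and is therefore refutable as stated (`not_weakHarnack_subsolution`, p172360:
the Gauss profile `exp(-L|x'|²)`), which makes that theorem vacuously hypothesised. Here the
hypothesis is the corrected `hWH′`, the statement Nazarov–Uraltseva's Lemma 4.2 ("a Lipschitz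
nonnegative SUPERsolution of (4.1)–(4.2) with `ε = +1`", `𝓜V = ∂ₜV - ΔV + b·∇V ≥ 0`,
`b = v + 2x'/|x'|²`, drift norm `‖v‖_{q,ℓ,Q^{2,1}_R}`, `Q^{2,1}_R = B_{2R} × ]-R², 0[`) and
Seregin's own first proof line (`∫(∂ₜπ η + ∇π·∇η - (u + 2x'/|x'|²)·∇η π) ≥ 4π₀ ∫ πη dx₃dt`,
`η ≥ 0`, the weak form of `∂ₜπ + b·∇π - Δπ ≥ 0` after `div b = 4π₀ δ_{axis}`) actually assert.
`hWH′` differs from `hWH` in exactly three clauses, everything else verbatim: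

* (a) (2.12) is the SUPERsolution inequality
  `0 ≤ ∂ₜΦ + DΦ[U] + (2/ϱ)∂_ϱΦ - ΔΦ` off the axis (the Gauss profile now fails it:
  `(2/ϱ)∂_ϱΦ - ΔΦ = -4L²ϱ²e^{-Lϱ²} < 0`);
* (b) the number `N` bounds the drift on the whole `Q^{2,1}_R = B(0, 2R) × ]-R², 0[`:
  `∫_{-R²}^0 (∫_{B(2R)} |u|³)^{4/3} ≤ N R²` (N–U Lemma 4.2 uses `‖v‖_{q,ℓ,Q^{2,1}_R}`);
* (c) the drift representative is divergence free off the axis: `div U(t, ·)(x) = 0` for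
  `t < 0`, `x' ≠ 0` (used by the energy method of the proof; free for the consumer).

* `ae_swirl_eq_zero_of_weakHarnack'` — for the ancient limit `(w, π)` with the properties (𝒜),
  (2.8) `Γ = ϱ u_φ ∈ L_∞(Q₋)`: corrected Lemma 2.2 ⟹ `swirl (w s) y = 0` a.e. on every `Q(a)`.

The proof is that of the superseded theorem (the "standard arguments": Lemma 2.2 applied to
`Γ₀ ∓ Γ`, `Γ = swirl V`, `V` the smooth representative off the backward-singular set `Σ`,
`Γ₀ = sup |Γ|`, at every scale, gives `Γ₀ ≤ (1 - β)Γ₀`), with three one-line changes: (a) the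
functions `Γ₀ ∓ Γ` solve (2.11) with EQUALITY off the axis (`affSwirl_classV_time`), so the
flipped inequality holds as well; (b) `N_R` on `B(2R) × ]-R², 0[` is fed from (2.10) at scale
`2R` (`lintegral_cube_fourThirds_le_of_cknAEss_cknE`) and monotonicity of `∫⁻` in the time
interval, `N = 4C₀K²`; (c) `V` is in the Seregin–Zajaczkowski class on the off-axis regions,
which is pointwise divergence free (`IsSmoothAxisymmetricSolutionOn.divergence_eq_zero`).

## References

* G. Seregin, Anal. Math. Phys. 10 (2020), Paper 46 = arXiv:2006.04140, proof of Thm. 2.1,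
  Lemma 2.2 and the paragraph after it (arXiv p. 8). [Seregin2020]
* A. I. Nazarov, N. N. Uraltseva, St. Petersburg Math. J. 23 (2012) 93–115 = arXiv:1011.1888,
  §4, (4.1)–(4.3), Remark 9, Lemma 4.2 (the model of Lemma 2.2). [NazarovUraltseva2012]
-/

-- the problem directory repeats the summit name (D-0017); core's `dupNamespace` linter fires
set_option linter.dupNamespace false

noncomputable section

open MeasureTheory Set Function Filter Topology TopologicalSpace Metric
open scoped NNReal ENNReal Laplacian

namespace Summit.NavierStokesRegularity.NavierStokesRegularity.Theorems.AxisymmetricKatoGlobal.EulerScaling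

open Literature.Analysis.FluidPDE Literature.Analysis.FluidPDE.SereginZajaczkowski2007
  Literature.Analysis.FluidPDE.Seregin2020

/-- **Seregin 2020, proof of Thm 2.1: "using standard arguments, we easily deduce from Lemma 2.2
that `Γ = 0`" — with Lemma 2.2 as a written-out hypothesis, CORRECTED rendering `hWH′`.**
Supersedes `ae_swirl_eq_zero_of_weakHarnack` (vacuous hypothesis, p172360). Let `(w, π)` have the
properties of the blow-up limit of `exists_ancientLimit_isAxisymmetric_swirl_bounded` that are
used: every slice of `w`, `π` axisymmetric ((𝒜)(ii)) and, for every `a > 0`, `(w, π)` suitable in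
`Q(a)` ((𝒜)(i)), `A, C, D ≤ K`, `A + E ≤ K` for a weak gradient on `Q(2a)` ((𝒜)(iii)), and (2.8)
`|swirl (w s) y| ≤ c` a.e. on `Q(a)`.
ASSUME Lemma 2.2 of the paper, rendered as follows (hypothesis `hWH′`; `Q₋ = {t < 0}`): for all
`M` and `N` there is `β > 0` ("`β` depends on `M` and `N_R` only") such that for all data — a pair
`(u, p)` with the properties (𝒜) ((i) suitable weak solution in every `Q(a)`; (ii) axisymmetric;
(iii) `A + C + D + (A + E) ≤ K` at every scale, `K` arbitrary) together with a representative
`U = u` a.e. on `Q₋`, continuous with `C^∞` slices and continuous gradient off the axis, and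
DIVERGENCE FREE off the axis (clause (c)) —, for every function `Φ` of the class 𝒱 — (i) a closed
set `S ⊆ {t ≤ 0} × {x' = 0}` of zero 1D-parabolic measure off which `Φ` is continuous with `C^∞`
slices and `∇Φ`, `∂ₑ∂ₑΦ` continuous in space–time; (ii) off the axis a classical, continuous
`∂ₜΦ`, with `∂ₜΦ, ∇Φ, ∇²Φ` bounded on every `]-ρ², 0[ × P(δ, ρ; ρ)`, and `Φ` bounded off `S` —
which is nonnegative and is a SUPERsolution (2.12)′ `∂ₜΦ + (U + 2x'/|x'|²)·∇Φ - ΔΦ ≥ 0` at every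
point of `Q₋` off the axis (clause (a)), and for all `R > 0`, `k > 0`, `M ≥ 1` with
`∫_{-R²}^0 (∫_{B(2R)} |u|³)^{4/3} ≤ N R²` (clause (b): the drift norm on `B(2R) × ]-R², 0[`),
(2.13) `Φ(0, x₃, t) ≥ k` for `-R² < t < 0`, `-2R < x₃ < 2R`, `(0, x₃, t) ∉ S`, and (2.14)
`Φ ≤ Mk` on `(B(2R) × ]-R², 0[) ∖ S`: THEN (2.15) `Φ ≥ βk` a.e. on `Q(R/2)`. CONCLUSION: the
swirl of `w` vanishes a.e. on every `Q(a)`. Proof in the module docstring.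
[cite: Seregin2020, proof of Thm 2.1, Lemma 2.2 and the paragraph after it (arXiv p. 8)] -/
theorem ae_swirl_eq_zero_of_weakHarnack' :
    ∀ (w : ℝ → EuclideanSpace ℝ (Fin 3) → EuclideanSpace ℝ (Fin 3))
      (π : ℝ → EuclideanSpace ℝ (Fin 3) → ℝ) (K : ℝ≥0) (c : ℝ),
      (∀ s, IsAxisymmetric (w s)) → (∀ s, IsAxisymmetricScalar (π s)) →
      (∀ a : ℝ, 0 < a →
        IsSuitableWeakSolutionInBall a 0 w π ∧
        cknAEss a 0 w ≤ K ∧ cknC a 0 w ≤ K ∧ cknD a 0 π ≤ K ∧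
        (∃ G' : ℝ → EuclideanSpace ℝ (Fin 3) →
            EuclideanSpace ℝ (Fin 3) →L[ℝ] EuclideanSpace ℝ (Fin 3),
          HasWeakSpatialGradientOn (parabolicCylinderOpens (2 * a) 0) w G' ∧
            cknAEss a 0 w + cknE a 0 G' ≤ K) ∧
        ∀ᵐ z ∂(volume.restrict (parabolicCylinder a (0 : ℝ × EuclideanSpace ℝ (Fin 3)))),
          |swirl (w z.1) z.2| ≤ c) →
      -- Lemma 2.2 of the paper, written out (corrected rendering `hWH′`)
      (∀ (M : ℝ) (N : ℝ≥0), ∃ β : ℝ, 0 < β ∧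
        ∀ (u U : ℝ → EuclideanSpace ℝ (Fin 3) → EuclideanSpace ℝ (Fin 3))
          (p : ℝ → EuclideanSpace ℝ (Fin 3) → ℝ) (K : ℝ≥0)
          (Φ : ℝ → EuclideanSpace ℝ (Fin 3) → ℝ) (S : Set (ℝ × EuclideanSpace ℝ (Fin 3))) (R k : ℝ),
          (∀ s, IsAxisymmetric (u s)) → (∀ s, IsAxisymmetricScalar (p s)) →
          (∀ a : ℝ, 0 < a →
            IsSuitableWeakSolutionInBall a 0 u p ∧
            cknAEss a 0 u ≤ K ∧
            cknC a 0 u ≤ K ∧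
            cknD a 0 p ≤ K ∧
            ∃ G' : ℝ → EuclideanSpace ℝ (Fin 3) →
                EuclideanSpace ℝ (Fin 3) →L[ℝ] EuclideanSpace ℝ (Fin 3),
              HasWeakSpatialGradientOn (parabolicCylinderOpens (2 * a) 0) u G' ∧
                cknAEss a 0 u + cknE a 0 G' ≤ K) →
          uncurry u =ᵐ[volume.restrict {z : ℝ × EuclideanSpace ℝ (Fin 3) | z.1 < 0}] uncurry U →
          ContinuousOn (uncurry U)
            {z : ℝ × EuclideanSpace ℝ (Fin 3) | z.1 < 0 ∧ cylRadius z.2 ≠ 0} →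
          (∀ z : ℝ × EuclideanSpace ℝ (Fin 3), z.1 < 0 → cylRadius z.2 ≠ 0 →
            ContDiffAt ℝ (⊤ : ℕ∞) (U z.1) z.2) →
          ContinuousOn (fun z : ℝ × EuclideanSpace ℝ (Fin 3) => fderiv ℝ (U z.1) z.2)
            {z : ℝ × EuclideanSpace ℝ (Fin 3) | z.1 < 0 ∧ cylRadius z.2 ≠ 0} →
          (∀ z : ℝ × EuclideanSpace ℝ (Fin 3), z.1 < 0 → cylRadius z.2 ≠ 0 →
            VectorCalculus.divergence (U z.1) z.2 = 0) →
          IsClosed S → (∀ z ∈ S, z.1 ≤ 0 ∧ cylRadius z.2 = 0) → IsParabolicNull 1 S →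
          ContinuousOn (uncurry Φ) ({z : ℝ × EuclideanSpace ℝ (Fin 3) | z.1 < 0} \ S) →
          (∀ z : ℝ × EuclideanSpace ℝ (Fin 3), z.1 < 0 → z ∉ S →
            ContDiffAt ℝ (⊤ : ℕ∞) (Φ z.1) z.2) →
          ContinuousOn (fun z : ℝ × EuclideanSpace ℝ (Fin 3) => fderiv ℝ (Φ z.1) z.2)
            ({z : ℝ × EuclideanSpace ℝ (Fin 3) | z.1 < 0} \ S) →
          (∀ e : EuclideanSpace ℝ (Fin 3), ContinuousOn (fun z : ℝ × EuclideanSpace ℝ (Fin 3) =>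
              fderiv ℝ (fun y => fderiv ℝ (Φ z.1) y e) z.2 e)
            ({z : ℝ × EuclideanSpace ℝ (Fin 3) | z.1 < 0} \ S)) →
          (∀ z : ℝ × EuclideanSpace ℝ (Fin 3), z.1 < 0 → cylRadius z.2 ≠ 0 →
            DifferentiableAt ℝ (fun r => Φ r z.2) z.1) →
          ContinuousOn (fun z : ℝ × EuclideanSpace ℝ (Fin 3) => deriv (fun r => Φ r z.2) z.1)
            {z : ℝ × EuclideanSpace ℝ (Fin 3) | z.1 < 0 ∧ cylRadius z.2 ≠ 0} →
          (∀ δ ρ : ℝ, 0 < δ → δ < ρ → ∃ C : ℝ, ∀ z : ℝ × EuclideanSpace ℝ (Fin 3),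
            z.1 ∈ Ioo (-ρ ^ 2) 0 → δ < cylRadius z.2 → cylRadius z.2 < ρ → |z.2 2| < ρ →
              |deriv (fun r => Φ r z.2) z.1| ≤ C ∧ ‖fderiv ℝ (Φ z.1) z.2‖ ≤ C ∧
              ∀ e : EuclideanSpace ℝ (Fin 3), ‖e‖ ≤ 1 →
                |fderiv ℝ (fun y => fderiv ℝ (Φ z.1) y e) z.2 e| ≤ C) →
          (∃ B : ℝ, ∀ z : ℝ × EuclideanSpace ℝ (Fin 3), z.1 < 0 → z ∉ S → |Φ z.1 z.2| ≤ B) →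
          (∀ z : ℝ × EuclideanSpace ℝ (Fin 3), z.1 < 0 → z ∉ S → 0 ≤ Φ z.1 z.2) →
          (∀ z : ℝ × EuclideanSpace ℝ (Fin 3), z.1 < 0 → cylRadius z.2 ≠ 0 →
            0 ≤ deriv (fun r => Φ r z.2) z.1 + fderiv ℝ (Φ z.1) z.2 (U z.1 z.2) +
                2 / cylRadius z.2 * partialDeriv (eR z.2) (Φ z.1) z.2 - (Laplacian.laplacian (Φ z.1)) z.2) →
          0 < R → 0 < k → 1 ≤ M →
          (∫⁻ s in Ioo (-R ^ 2) 0, (∫⁻ y in ball (0 : EuclideanSpace ℝ (Fin 3)) (2 * R),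
              ‖u s y‖ₑ ^ (3 : ℕ)) ^ (4 / 3 : ℝ) ≤ (N : ℝ≥0∞) * ENNReal.ofReal R ^ 2) →
          (∀ z : ℝ × EuclideanSpace ℝ (Fin 3), z.1 ∈ Ioo (-R ^ 2) 0 → cylRadius z.2 = 0 →
            z.2 2 ∈ Ioo (-(2 * R)) (2 * R) → z ∉ S → k ≤ Φ z.1 z.2) →
          (∀ z : ℝ × EuclideanSpace ℝ (Fin 3), z.1 ∈ Ioo (-R ^ 2) 0 →
            z.2 ∈ ball (0 : EuclideanSpace ℝ (Fin 3)) (2 * R) → z ∉ S → Φ z.1 z.2 ≤ M * k) →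
          ∀ᵐ z ∂(volume.restrict (parabolicCylinder (R / 2) (0 : ℝ × EuclideanSpace ℝ (Fin 3)))),
            β * k ≤ Φ z.1 z.2) →
      ∀ a : ℝ, 0 < a →
        ∀ᵐ z ∂(volume.restrict (parabolicCylinder a (0 : ℝ × EuclideanSpace ℝ (Fin 3)))),
          swirl (w z.1) z.2 = 0 := by
  -- adapted from …Theorems/AxisymmetricExtremalityAxisymmetricKatoGlobalStubSeregin2020TypeIISwirlVanishes
  -- (`ae_swirl_eq_zero_of_weakHarnack`): same proof, three one-line changes marked (a), (b), (c)
  intro w π K c hax hπax hall hWH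
  have hball : ∀ a : ℝ, 0 < a → IsSuitableWeakSolutionInBall a 0 w π := fun a ha => (hall a ha).1
  have hswb : ∀ a : ℝ, 0 < a →
      ∀ᵐ z ∂(volume.restrict (parabolicCylinder a (0 : ℝ × EuclideanSpace ℝ (Fin 3)))),
        |swirl (w z.1) z.2| ≤ c := fun a ha => (hall a ha).2.2.2.2.2
  -- ### the backward-singular set `Σ` and the global representative `V`
  obtain ⟨hcl, haxis, hnull⟩ := ancientLimit_backwardSingular_structure w π hax hball
  set A : Set (ℝ × EuclideanSpace ℝ (Fin 3)) := {z : ℝ × EuclideanSpace ℝ (Fin 3) | z.1 ≤ 0 ∧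
    ¬ ∃ r > 0, eLpNorm (uncurry w) ∞ (volume.restrict (parabolicCylinder r z)) < ∞} with hA
  obtain ⟨V, hVae, hVcl⟩ := exists_smooth_repr_off_backwardSingular w π hax hball A hA
  have hAvol : volume A = 0 :=
    measure_mono_null (fun z hz => haxis z hz) volume_setOf_cylRadius_snd_eq_zero
  -- continuity of `Γ = swirl V` on `{t < 0} ∖ Σ`
  have hΓc : ContinuousOn (fun z : ℝ × EuclideanSpace ℝ (Fin 3) => swirl (V z.1) z.2)
      ({z : ℝ × EuclideanSpace ℝ (Fin 3) | z.1 < 0} \ A) :=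
    (affSwirl_classV_spatial hcl haxis hVcl 0 1).1.congr fun z _ => by
      show swirl (V z.1) z.2 = 0 + 1 * swirl (V z.1) z.2
      ring
  -- ### a.e. bounds on `Q(b)` hold at every point of `Q(b) ∖ Σ`
  have hpt : ∀ (b B : ℝ), 0 < b →
      (∀ᵐ z ∂(volume.restrict (parabolicCylinder b (0 : ℝ × EuclideanSpace ℝ (Fin 3)))),
        |swirl (V z.1) z.2| ≤ B) →
      ∀ z ∈ parabolicCylinder b (0 : ℝ × EuclideanSpace ℝ (Fin 3)) \ A, |swirl (V z.1) z.2| ≤ B := by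
    intro b B hb hB
    have hO : IsOpen (parabolicCylinder b (0 : ℝ × EuclideanSpace ℝ (Fin 3)) \ A) :=
      (isOpen_parabolicCylinder b 0).sdiff hcl
    have hsub : parabolicCylinder b (0 : ℝ × EuclideanSpace ℝ (Fin 3)) \ A ⊆
        {z : ℝ × EuclideanSpace ℝ (Fin 3) | z.1 < 0} \ A := by
      rintro z ⟨hz, hzA⟩
      refine ⟨?_, hzA⟩
      have h := (mem_parabolicCylinder.1 hz).1.2
      simpa using h
    exact forall_le_of_ae_le_of_continuousOn' hO
      ((continuous_abs.comp_continuousOn hΓc).mono hsub)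
      (ae_restrict_of_ae_restrict_of_subset sdiff_subset hB)
  -- the bound `|Γ| ≤ c` at every point of `{t < 0} ∖ Σ`
  have hΓle : ∀ z : ℝ × EuclideanSpace ℝ (Fin 3), z.1 < 0 → z ∉ A → |swirl (V z.1) z.2| ≤ c := by
    intro z hz hzA
    have hbpos : (0 : ℝ) < (⌈‖z.2‖ + |z.1|⌉₊ : ℝ) + 1 := by positivity
    refine hpt _ c hbpos ?_ z ⟨mem_parabolicCylinder_natCeil hz, hzA⟩
    filter_upwards [hVae _ hbpos, hswb _ hbpos] with q hq hqc
    have e : w q.1 q.2 = V q.1 q.2 := hq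
    simpa only [swirl, e] using hqc
  -- ### `Γ₀ = sup |Γ|`
  set T : Set ℝ := (fun z : ℝ × EuclideanSpace ℝ (Fin 3) => |swirl (V z.1) z.2|) ''
    ({z : ℝ × EuclideanSpace ℝ (Fin 3) | z.1 < 0} \ A) with hT
  have hTbdd : BddAbove T := by
    refine ⟨c, ?_⟩
    rintro _ ⟨z, hz, rfl⟩
    exact hΓle z hz.1 hz.2
  set z₀ : ℝ × EuclideanSpace ℝ (Fin 3) := ((-1 : ℝ), EuclideanSpace.single (0 : Fin 3) (1 : ℝ))
    with hz₀
  have hz₀mem : z₀ ∈ {z : ℝ × EuclideanSpace ℝ (Fin 3) | z.1 < 0} \ A := by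
    refine ⟨by norm_num [hz₀], fun h => ?_⟩
    have h0 := haxis z₀ h
    rw [hz₀, cylRadius_eq_zero_iff] at h0
    simp at h0
  have hTne : T.Nonempty := ⟨_, mem_image_of_mem _ hz₀mem⟩
  set Γ₀ : ℝ := sSup T with hΓ₀
  have hleΓ₀ : ∀ z : ℝ × EuclideanSpace ℝ (Fin 3), z.1 < 0 → z ∉ A → |swirl (V z.1) z.2| ≤ Γ₀ :=
    fun z hz hzA => le_csSup hTbdd (mem_image_of_mem _ (show z ∈ _ \ A from ⟨hz, hzA⟩))
  have hΓ₀le : ∀ B : ℝ, (∀ z : ℝ × EuclideanSpace ℝ (Fin 3), z.1 < 0 → z ∉ A →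
      |swirl (V z.1) z.2| ≤ B) → Γ₀ ≤ B := by
    intro B hB
    refine csSup_le hTne ?_
    rintro _ ⟨z, hz, rfl⟩
    exact hB z hz.1 hz.2
  have hΓ₀nn : 0 ≤ Γ₀ := (abs_nonneg _).trans (hleΓ₀ z₀ hz₀mem.1 hz₀mem.2)
  -- ### `Γ = 0` on `{t < 0} ∖ Σ`
  have hzero : ∀ z : ℝ × EuclideanSpace ℝ (Fin 3), z.1 < 0 → z ∉ A → swirl (V z.1) z.2 = 0 := by
    -- (2.10): `N_R ≤ N(K)` at every scale; (b) the drift norm on `B(2R) × ]-R², 0[` from the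
    -- bound at scale `2R` and monotonicity in the time interval, `N = 4C₀K²`
    obtain ⟨C₀, hC₀⟩ := lintegral_cube_fourThirds_le_of_cknAEss_cknE
    obtain ⟨β, hβ, hL⟩ := hWH 2 (4 * C₀ * K ^ 2)
    have hNR : ∀ R : ℝ, 0 < R →
        ∫⁻ s in Ioo (-R ^ 2) 0, (∫⁻ y in ball (0 : EuclideanSpace ℝ (Fin 3)) (2 * R),
          ‖w s y‖ₑ ^ (3 : ℕ)) ^ (4 / 3 : ℝ) ≤
          ((4 * C₀ * K ^ 2 : ℝ≥0) : ℝ≥0∞) * ENNReal.ofReal R ^ 2 := by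
      intro R hR
      have h2R : 0 < 2 * R := by positivity
      obtain ⟨G', hG', hAE⟩ := (hall (2 * R) h2R).2.2.2.2.1
      have hle2 : parabolicCylinderOpens (2 * R) (0 : ℝ × EuclideanSpace ℝ (Fin 3)) ≤
          parabolicCylinderOpens (2 * (2 * R)) (0 : ℝ × EuclideanSpace ℝ (Fin 3)) :=
        fun q hq => parabolicCylinder_mono h2R.le (by linarith) _ hq
      have hA' : cknAEss (2 * R) (0 : ℝ × EuclideanSpace ℝ (Fin 3)) w ≤ K := le_trans le_self_add hAE
      have hE' : cknE (2 * R) (0 : ℝ × EuclideanSpace ℝ (Fin 3)) G' ≤ K := le_trans le_add_self hAE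
      have hIoo : Ioo (-R ^ 2) (0 : ℝ) ⊆ Ioo (-(2 * R) ^ 2) 0 :=
        Ioo_subset_Ioo (by nlinarith) le_rfl
      have h2 : ENNReal.ofReal (2 * R) = 2 * ENNReal.ofReal R := by
        rw [ENNReal.ofReal_mul (by norm_num : (0 : ℝ) ≤ 2), ENNReal.ofReal_ofNat]
      calc ∫⁻ s in Ioo (-R ^ 2) 0, (∫⁻ y in ball (0 : EuclideanSpace ℝ (Fin 3)) (2 * R),
            ‖w s y‖ₑ ^ (3 : ℕ)) ^ (4 / 3 : ℝ)
            ≤ ∫⁻ s in Ioo (-(2 * R) ^ 2) 0, (∫⁻ y in ball (0 : EuclideanSpace ℝ (Fin 3)) (2 * R),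
              ‖w s y‖ₑ ^ (3 : ℕ)) ^ (4 / 3 : ℝ) := lintegral_mono_set hIoo
        _ ≤ C₀ * ENNReal.ofReal (2 * R) ^ 2 * K ^ 2 :=
            hC₀ w G' (2 * R) K h2R (hG'.mono hle2) hA' hE'
        _ = ((4 * C₀ * K ^ 2 : ℝ≥0) : ℝ≥0∞) * ENNReal.ofReal R ^ 2 := by
            rw [h2]
            push_cast
            ring
    -- `w = V` a.e. on `{t < 0}`, and the velocity representative off the axis
    have hUae : uncurry w =ᵐ[volume.restrict {z : ℝ × EuclideanSpace ℝ (Fin 3) | z.1 < 0}] uncurry V := by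
      rw [setOf_fst_lt_zero_eq_iUnion]
      exact (ae_restrict_iUnion_iff _ _).2 fun n => hVae _ (by positivity)
    obtain ⟨hUc, hUs, hUf⟩ := velocity_repr_offAxis haxis hVcl
    -- (c) the representative is divergence free off the axis (the class on the off-axis regions)
    have hUdiv : ∀ z : ℝ × EuclideanSpace ℝ (Fin 3), z.1 < 0 → cylRadius z.2 ≠ 0 →
        VectorCalculus.divergence (V z.1) z.2 = 0 := by
      intro z hz hρ
      have hapos : (0 : ℝ) < (⌈‖z.2‖ + |z.1|⌉₊ : ℝ) + 1 := by positivity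
      exact (isSmoothAxisymmetricSolutionOn_offAxisRegion haxis hVcl hapos).divergence_eq_zero
        (mem_offAxisRegion_natCeil hz hρ)
    have hAx : ∀ z ∈ A, z.1 ≤ 0 ∧ cylRadius z.2 = 0 := fun z hz => ⟨hz.1, haxis z hz⟩
    have hdata : ∀ a : ℝ, 0 < a →
        IsSuitableWeakSolutionInBall a 0 w π ∧
        cknAEss a (0 : ℝ × EuclideanSpace ℝ (Fin 3)) w ≤ K ∧
        cknC a (0 : ℝ × EuclideanSpace ℝ (Fin 3)) w ≤ K ∧
        cknD a (0 : ℝ × EuclideanSpace ℝ (Fin 3)) π ≤ K ∧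
        ∃ G' : ℝ → EuclideanSpace ℝ (Fin 3) →
            EuclideanSpace ℝ (Fin 3) →L[ℝ] EuclideanSpace ℝ (Fin 3),
          HasWeakSpatialGradientOn
              (parabolicCylinderOpens (2 * a) (0 : ℝ × EuclideanSpace ℝ (Fin 3))) w G' ∧
            cknAEss a (0 : ℝ × EuclideanSpace ℝ (Fin 3)) w +
              cknE a (0 : ℝ × EuclideanSpace ℝ (Fin 3)) G' ≤ K := fun a ha =>
      ⟨(hall a ha).1, (hall a ha).2.1, (hall a ha).2.2.1, (hall a ha).2.2.2.1, (hall a ha).2.2.2.2.1⟩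
    -- `|s Γ| ≤ Γ₀` off `Σ` for `|s| ≤ 1`
    have hsΓ : ∀ s : ℝ, |s| ≤ 1 → ∀ z : ℝ × EuclideanSpace ℝ (Fin 3), z.1 < 0 → z ∉ A →
        |s * swirl (V z.1) z.2| ≤ Γ₀ := by
      intro s hs z hz hzA
      rw [abs_mul]
      have h1 := hleΓ₀ z hz hzA
      nlinarith [abs_nonneg (swirl (V z.1) z.2), abs_nonneg s]
    -- ### Lemma 2.2 applied to `Γ₀ + s Γ`, `|s| ≤ 1`, at scale `R`
    have happ : 0 < Γ₀ → ∀ s : ℝ, |s| ≤ 1 → ∀ R : ℝ, 0 < R →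
        ∀ᵐ z ∂(volume.restrict (parabolicCylinder (R / 2) (0 : ℝ × EuclideanSpace ℝ (Fin 3)))),
          β * Γ₀ ≤ Γ₀ + s * swirl (V z.1) z.2 := by
      intro hΓ₀pos s hs R hR
      obtain ⟨hS1, hS2, hS3, hS4⟩ := affSwirl_classV_spatial hcl haxis hVcl Γ₀ s
      obtain ⟨-, hT2, hT3, hT4⟩ := affSwirl_classV_time V π A haxis hVcl Γ₀ s
      have hB : ∀ δ ρ : ℝ, 0 < δ → δ < ρ → ∃ C : ℝ, ∀ z : ℝ × EuclideanSpace ℝ (Fin 3),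
          z.1 ∈ Ioo (-ρ ^ 2) 0 → δ < cylRadius z.2 → cylRadius z.2 < ρ → |z.2 2| < ρ →
            |deriv (fun r => Γ₀ + s * swirl (V r) z.2) z.1| ≤ C ∧
            ‖fderiv ℝ (fun y => Γ₀ + s * swirl (V z.1) y) z.2‖ ≤ C ∧
            ∀ e : EuclideanSpace ℝ (Fin 3), ‖e‖ ≤ 1 →
              |fderiv ℝ (fun y => fderiv ℝ (fun y => Γ₀ + s * swirl (V z.1) y) y e) z.2 e| ≤ C :=
        affSwirl_classV_bounds w V π A hball hA haxis hVae hVcl Γ₀ s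
      -- (a): (2.11) holds with equality off the axis, so the supersolution inequality holds
      refine hL w V π K (fun t y => Γ₀ + s * swirl (V t) y) A R Γ₀ hax hπax hdata hUae hUc hUs hUf
        hUdiv hcl hAx hnull hS1 hS2 hS3 hS4 hT2 hT3 hB ⟨2 * Γ₀, fun z hz hzA => ?_⟩
        (fun z hz hzA => ?_) (fun z hz hρ => (hT4 z hz hρ).ge) hR hΓ₀pos (by norm_num) (hNR R hR)
        (fun z _ hzax _ _ => ?_) (fun z hz _ hzA => ?_)
      · -- `|Γ₀ + sΓ| ≤ 2Γ₀`
        have h2 := hsΓ s hs z hz hzA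
        calc |Γ₀ + s * swirl (V z.1) z.2| ≤ |Γ₀| + |s * swirl (V z.1) z.2| := abs_add_le _ _
          _ ≤ Γ₀ + Γ₀ := add_le_add (abs_of_nonneg hΓ₀nn).le h2
          _ = 2 * Γ₀ := by ring
      · -- `0 ≤ Γ₀ + sΓ`
        have h2 := hsΓ s hs z hz hzA
        have h3 := neg_abs_le (s * swirl (V z.1) z.2)
        show 0 ≤ Γ₀ + s * swirl (V z.1) z.2
        linarith
      · -- on the axis the swirl vanishes: `Γ₀ + sΓ = Γ₀ = k`
        show Γ₀ ≤ Γ₀ + s * swirl (V z.1) z.2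
        rw [swirl_eq_zero_of_cylRadius_eq_zero _ hzax, mul_zero, add_zero]
      · -- `Γ₀ + sΓ ≤ 2Γ₀ = Mk`
        have h2 := hsΓ s hs z hz.2 hzA
        have h3 := le_abs_self (s * swirl (V z.1) z.2)
        show Γ₀ + s * swirl (V z.1) z.2 ≤ 2 * Γ₀
        linarith
    -- ### `Γ₀ = 0`: otherwise `|Γ| ≤ (1 - β)Γ₀` everywhere, so `Γ₀ ≤ (1 - β)Γ₀`
    intro z₁ hz₁ hz₁A
    by_contra hz₁ne
    have hΓ₀pos : 0 < Γ₀ := lt_of_lt_of_le (abs_pos.2 hz₁ne) (hleΓ₀ z₁ hz₁ hz₁A)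
    have hdec : ∀ z : ℝ × EuclideanSpace ℝ (Fin 3), z.1 < 0 → z ∉ A →
        |swirl (V z.1) z.2| ≤ (1 - β) * Γ₀ := by
      intro z hz hzA
      have hb : (0 : ℝ) < (⌈‖z.2‖ + |z.1|⌉₊ : ℝ) + 1 := by positivity
      have hp1 := happ hΓ₀pos 1 (by norm_num) (2 * ((⌈‖z.2‖ + |z.1|⌉₊ : ℝ) + 1)) (by positivity)
      have hm1 := happ hΓ₀pos (-1) (by norm_num) (2 * ((⌈‖z.2‖ + |z.1|⌉₊ : ℝ) + 1)) (by positivity)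
      rw [mul_div_cancel_left₀ _ (two_ne_zero' ℝ)] at hp1 hm1
      refine hpt _ ((1 - β) * Γ₀) hb ?_ z ⟨mem_parabolicCylinder_natCeil hz, hzA⟩
      filter_upwards [hp1, hm1] with q hq1 hq2
      rw [abs_le]
      constructor <;> linarith
    have hfin := hΓ₀le _ hdec
    nlinarith
  -- ### conclusion: `Σ` is null and `w = V` a.e.
  intro a ha
  have h1 : ∀ᵐ z ∂(volume : Measure (ℝ × EuclideanSpace ℝ (Fin 3))), z ∉ A :=
    measure_eq_zero_iff_ae_notMem.1 hAvol
  have h2 : ∀ᵐ z ∂(volume.restrict (parabolicCylinder a (0 : ℝ × EuclideanSpace ℝ (Fin 3)))),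
      z ∈ parabolicCylinder a (0 : ℝ × EuclideanSpace ℝ (Fin 3)) :=
    ae_restrict_mem (isOpen_parabolicCylinder a 0).measurableSet
  filter_upwards [hVae a ha, ae_restrict_of_ae h1, h2] with z hz hzA hzQ
  have ht : z.1 < 0 := by
    have h := (mem_parabolicCylinder.1 hzQ).1.2
    simpa using h
  have e : w z.1 z.2 = V z.1 z.2 := hz
  have h0 := hzero z ht hzA
  simp only [swirl] at h0 ⊢
  rw [e]
  exact h0

end Summit.NavierStokesRegularity.NavierStokesRegularity.Theorems.AxisymmetricKatoGlobal.EulerScaling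

end
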